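import Literature.Barriers.ValiantsHypothesis.BIJL18Thm4StrengthenedPipeline
import Literature.Barriers.ValiantsHypothesis.BIJL18Thm4StrengthenedMachine
import Literature.Barriers.ValiantsHypothesis.BIJL18Thm4OfPIT
import Literature.Computability.AlgebraicComplexity.PITLanguageModP
import Literature.Computability.Complexity.ThreeDMMachine
import HarnessLib

/-!
# Bläser–Ikenmeyer–Jindal–Lysikov 2018, Thm 4 STRENGTHENED — the `∃BPP` verifier, its correctness read
# modulo the characteristic, and the discharge `BIJL2018_thm4_strengthened_holds`

Closer of the val-lit `BIJL2018_thm4_strengthened` roster (F-S0 `E3SATBoundedOccurrence.lean`, F-S1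
`BIJL18Thm4StrengthenedSemantics.lean` (p7), F-S1b `BIJL18Thm4StrengthenedPipeline.lean`, F-S2
`BIJL18Thm4StrengthenedMachine.lean` (t21)). The typed fact (`BIJL18MatrixCompletion.lean`, ECCC TR18-064
p. 12, remark after Obs. 17): unless `coNP ⊆ ∃·BPP` there are `t, r : ℕ → ℕ` of linear growth and a constant `c`
such that for every family `S n` of equation sets with zero set exactly `C^{n,t n,c}_{r n}` and every exponent
`k`, infinitely often some member of `S n` has no constant-free fan-in-two circuit of size `≤ n^k + k`.

PROOF (the printed proof of Thm 4, pp. 11–12, run on a bounded-occurrence source; DISCLOSED DEVIATIONS below).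
Fix `t n = n + 1`, `r n = 13 ⌊n/20⌋`, `c = 20 (B + 1)` where `B` is the occurrence bound of the NP-hard language
`E3SATOcc B` (codes of satisfiable E3-CNFs with every variable in `≤ B` clauses; NP-hard in the tree as the
yes-side of Dinur's bounded-occurrence gap-E3SAT, `E3SATOcc_occB_isNPHard`). Given `S`, `k`, `n₀`, suppose every
member of `S n` (`n ≥ n₀`) has a circuit of size `≤ n^k + k`. The `∃·BPP` verifier for the COMPLEMENT of
`E3SATOcc B`: on `⟨w, y⟩`, accept outright if `w` is not the canonical code of an E3-CNF with occurrence bound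
`B` (`easyFnS`); otherwise (`mainFnS`) read the guessed gate list `y`, form `ψ = gjs (padE3 n₀ φ)` (the
Garey–Johnson–Stockmeyer 2-CNF of `φ` padded by `n₀` fresh satisfiable clauses: `10 m′` clauses, threshold `7 m′`,
coded tensor `T_ψ` of size `n = 20 m′` with `n + 1` slices, each of rank `≤ c`, and rank bound `13 m′ = r n`) and
ask a `BPP` identity test modulo the characteristic the two words written by F-S2: the chart-test word
(`p ∘ g_c ≡ 0`, `g_c` the Lemma-16 parametrisation with slice-rank profile `c`) must be accepted and the
evaluation word (`p(T_ψ)`) rejected. SOUNDNESS: `T_ψ ∈ C^{n,n+1,c}_{r n}` unless `\underline{CR}(T_ψ) > 13 m′`,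
and `p ∘ g_c = 0` forces `p` to vanish on `C` (Obs. 17 closure direction in the tree), so acceptance gives
`\underline{CR}(T_ψ) > 2s − 7m′`, i.e. fewer than `7m′` clauses of `ψ` satisfiable (Lemma 14), i.e. `φ`
unsatisfiable (GJS). COMPLETENESS: if `φ` is unsatisfiable, `T_ψ ∉ C^{n,n+1,c}_{r n}` = zero set of `S n`, so some
`q ∈ S n` has `q(T_ψ) ≠ 0`; `q` vanishes on `C ⊇ im g_c` and has a small constant-free circuit (`n ≥ n₀` by the
padding), which descends to a short accepted gate list. Hence `(E3SATOcc B)ᶜ ∈ ∃·BPP`, so `coNP ⊆ ∃·BPP`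
(`coNP_subset_polyExists_BPP_of_isNPHard_of_compl_mem`) — contradiction.

* §1 the verifier (`chartFnS/evalFnS/mainFnS/easyFnS` = F-S2's string functions, two adaptive queries,
  `verifierS`, `verifierS_mem_BPP`);
* §2 correctness with an identity test modulo `p` on circuit words (`testsS_iff_zmod`,
  `not_mem_of_mem_verifierS_zmod`, `exists_mem_verifierS_zmod`, `compl_E3SATOcc_mem_polyExists_BPP_zmod`);
* §3 **`BIJL2018_thm4_strengthened_of_randomizedPITMod`** (every infinite field of characteristic `p`,
  `p = 0` included) and the discharge **`BIJL2018_thm4_strengthened_holds`** on the tree's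
  `PITLanguageMod (ringChar K) ∈ BPP` (uniform in the characteristic, pattern of `BIJL2018_thm4_holds`).

DISCLOSED DEVIATIONS FROM PRINT (the source states the strengthening in one sentence, without proof):
(1) the coNP-hard source is bounded-occurrence E3SAT, not plain Max-2-SAT — necessary, since the slice `A_k` of
the Thm-3 tensor has rank = number of literal positions on `x_k` and "a constant `c`" (Obs. 17) presupposes
bounded occurrence; (2) the grading `t_n = n + 1`, `r_n = 13 ⌊n/20⌋` is read off the Garey–Johnson–Stockmeyer map
(`s = 10 m′`, `b = 7 m′`) and the "let `n` be large enough" step pads the E3-CNF by fresh satisfiable clauses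
(padding the 2-CNF as in the Thm-4 file would break the grading); (3) the identity tests are the tree's `BPP`
tests for integer circuit words read modulo `ringChar K` (`PITLanguageMod`), guessed circuits are
Kabanets–Impagliazzo gate lists (as in the Thm-4 files); (4) constant-free = sign constants `{−1,0,1}`, fan-in two,
exactly as in the typed fact. Theorem-only file (plumbing `def`s via `Classical.choose`), no new fact.
HONEST FRAMING (val-lit): a published CONDITIONAL barrier remark (antecedent `coNP ⊄ ∃BPP` inside the statement)
about the varieties `C^{n,t,c}_r` of border completion rank with bounded slice ranks, now a theorem of the tree for
every infinite field; nothing about `VP`, the determinant or the permanent; `VP ≠ VNP` is NOT proved.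

## References

* [BlaserIkenmeyerJindalLysikov2018] M. Bläser, C. Ikenmeyer, G. Jindal, V. Lysikov, *Generalized matrix
  completion and algebraic natural proofs*, STOC 2018 / ECCC TR18-064: remark after Obs. 17 (p. 12), Thm 4
  (proof pp. 11–12), Thm 3 / Lemma 14, Lemma 16, Obs. 17, §5 p. 13 (bounded occurrence).
* [GareyJohnsonStockmeyer1976] M. R. Garey, D. S. Johnson, L. Stockmeyer, TCS 1 (1976), Thm. 1.1.
* [AroraBarak2009] S. Arora, B. Barak, *Computational Complexity: A Modern Approach*, CUP 2009, Def. 5.3 (∃·),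
  §7.5.2, Thm. 11.9 / Claim 22.37.
* [KabanetsImpagliazzo2004] V. Kabanets, R. Impagliazzo, Comput. Complexity 13 (2004), §2.3.
-/

noncomputable section

open MvPolynomial

namespace Literature.Barriers.ValiantsHypothesis

universe u

namespace BIJL2018Thm4S

open Literature.Computability.AlgebraicComplexity Literature.Computability.Complexity ArithCircuit KIReduction
open _root_.Computability CodeFP Brick NegCNF CNF MaxTwoSat BIJL18NPHard BIJL2018Thm4
open BILPS2019Cor42 (wordE evalCircuit eval_evalCircuit decLang decLang_mem_P union_mem_BPP_of_mem_P_left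
  size_le_length_circuitWord)
open scoped Literature.Computability.Complexity.Notation

/-! ### §1. The `∃·BPP` verifier: two adaptive queries to a randomised identity test -/

section Verifier

open AdQuery

variable (B₀ n₀ c : ℕ)

/-- The chart-test writer of F-S2 as a string function. [cite: BlaserIkenmeyerJindalLysikov2018, Thm. 4 (proof, step (2))] -/
def chartFnS : List Bool → List Bool := Classical.choose (exists_chartFnS n₀ c)

/-- `chartFnS ∈ FP`. [cite: AroraBarak2009, §1.3] -/
theorem chartFnS_mem_FP : chartFnS n₀ c ∈ FP := (Classical.choose_spec (exists_chartFnS n₀ c)).1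

/-- Value of `chartFnS` on an input pair. [cite: BlaserIkenmeyerJindalLysikov2018, Thm. 4 (proof, step (2))] -/
theorem chartFnS_apply (w y : List Bool) :
    chartFnS n₀ c (boolPair w y) = wordE (chartInstS n₀ c (decCNF w, y)) :=
  (Classical.choose_spec (exists_chartFnS n₀ c)).2 w y

/-- The evaluation writer of F-S2 as a string function. [cite: BlaserIkenmeyerJindalLysikov2018, Thm. 4 (proof, step (3))] -/
def evalFnS : List Bool → List Bool := Classical.choose (exists_evalFnS n₀)

/-- `evalFnS ∈ FP`. [cite: AroraBarak2009, §1.3] -/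
theorem evalFnS_mem_FP : evalFnS n₀ ∈ FP := (Classical.choose_spec (exists_evalFnS n₀)).1

/-- Value of `evalFnS` on an input pair. [cite: BlaserIkenmeyerJindalLysikov2018, Thm. 4 (proof, step (3))] -/
theorem evalFnS_apply (w y : List Bool) :
    evalFnS n₀ (boolPair w y) = wordE (evalInstS n₀ (decCNF w, y)) :=
  (Classical.choose_spec (exists_evalFnS n₀)).2 w y

/-- The main-case test (canonical E3 code with occurrence bound `B₀`) as a string function. [cite: AroraBarak2009, §1.3] -/
def mainFnS : List Bool → List Bool := Classical.choose (exists_mainFnS B₀)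

/-- `mainFnS ∈ FP`. [cite: AroraBarak2009, §1.3] -/
theorem mainFnS_mem_FP : mainFnS B₀ ∈ FP := (Classical.choose_spec (exists_mainFnS B₀)).1

/-- Value of `mainFnS`. [cite: AroraBarak2009, §1.3] -/
theorem mainFnS_apply (w y : List Bool) :
    mainFnS B₀ (boolPair w y) = [decide (encodingCNF.encode (decCNF w) = w) && mainS B₀ (decCNF w)] :=
  (Classical.choose_spec (exists_mainFnS B₀)).2 w y

/-- The easy-accept test as a string function. [cite: AroraBarak2009, §1.3] -/
def easyFnS : List Bool → List Bool := Classical.choose (exists_easyFnS B₀)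

/-- `easyFnS ∈ FP`. [cite: AroraBarak2009, §1.3] -/
theorem easyFnS_mem_FP : easyFnS B₀ ∈ FP := (Classical.choose_spec (exists_easyFnS B₀)).1

/-- Value of `easyFnS`. [cite: AroraBarak2009, §1.3] -/
theorem easyFnS_apply (w y : List Bool) :
    easyFnS B₀ (boolPair w y) = [!decide (encodingCNF.encode (decCNF w) = w) || easyS B₀ (decCNF w)] :=
  (Classical.choose_spec (exists_easyFnS B₀)).2 w y

/-- **The query map**: first the chart-test word, then the evaluation word.
[cite: BlaserIkenmeyerJindalLysikov2018, Thm. 4 (proof, steps (2)–(3))] -/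
theorem exists_queryFnS : ∃ Q ∈ FP, ∀ z bits : List Bool,
    Q (boolPair z bits) = if bits.length = 0 then chartFnS n₀ c z else evalFnS n₀ z := by
  have hc : CodeFP strE strE (chartFnS n₀ c) := of_fn _ (chartFnS_mem_FP n₀ c) fun _ => rfl
  have he : CodeFP strE strE (evalFnS n₀) := of_fn _ (evalFnS_mem_FP n₀) fun _ => rfl
  obtain ⟨Q, hQ, hQw⟩ := (natEq.comp ((strNatLength.comp (snd strE strE)).pair (const _ 0))).ite
    (hc.comp (fst _ _)) (he.comp (fst _ _))
  refine ⟨Q, hQ, fun z bits => ?_⟩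
  have h := hQw (z, bits)
  simp only [pairE_apply, decide_eq_true_eq] at h
  exact h

/-- The query map. [cite: BlaserIkenmeyerJindalLysikov2018, Thm. 4 (proof)] -/
def queryFnS : List Bool → List Bool := Classical.choose (exists_queryFnS n₀ c)

/-- `queryFnS ∈ FP`. [cite: AroraBarak2009, §1.3] -/
theorem queryFnS_mem_FP : queryFnS n₀ c ∈ FP := (Classical.choose_spec (exists_queryFnS n₀ c)).1

/-- Value of the query map. [cite: BlaserIkenmeyerJindalLysikov2018, Thm. 4 (proof)] -/
theorem queryFnS_apply (z bits : List Bool) :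
    queryFnS n₀ c (boolPair z bits) = if bits.length = 0 then chartFnS n₀ c z else evalFnS n₀ z :=
  (Classical.choose_spec (exists_queryFnS n₀ c)).2 z bits

variable (Bpit : Language Bool)

/-- **The two-query language**: ask `Bpit` the chart-test word and the evaluation word; accept iff the answers
were (yes, no). [cite: BlaserIkenmeyerJindalLysikov2018, Thm. 4 (proof: "Decide whether p(g) = 0 … Check whether p(T_φ) ≠ 0. If yes, then accept")] -/
def twoQueryS : Language Bool := adLang (queryFnS n₀ c) (Polynomial.C 2) decLang Bpit

/-- **`twoQueryS ∈ BPP` for `Bpit ∈ BPP`.** [cite: AroraBarak2009, §7.5.2] -/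
theorem twoQueryS_mem_BPP (hB : Bpit ∈ BPP) : twoQueryS n₀ c Bpit ∈ BPP :=
  AdBPPSim.adLang_mem_BPP hB (queryFnS_mem_FP n₀ c) _ decLang_mem_P

/-- **Membership in the two-query language**: chart-test word in `Bpit`, evaluation word not in `Bpit`.
[cite: BlaserIkenmeyerJindalLysikov2018, Thm. 4 (proof)] -/
theorem mem_twoQueryS_iff (z : List Bool) :
    z ∈ twoQueryS n₀ c Bpit ↔ chartFnS n₀ c z ∈ Bpit ∧ evalFnS n₀ z ∉ Bpit := by
  rw [twoQueryS, mem_adLang_iff, Polynomial.eval_C]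
  have h2 : adBits (queryFnS n₀ c) Bpit z 2 =
      [Bpit.boolIndicator (chartFnS n₀ c z), Bpit.boolIndicator (evalFnS n₀ z)] := by
    rw [show (2 : ℕ) = 0 + 1 + 1 from rfl, adBits_succ, adBits_succ, adBits_zero, queryFnS_apply, List.nil_append,
      queryFnS_apply]
    simp
  rw [h2]
  change sndF (boolPair z [Bpit.boolIndicator (chartFnS n₀ c z), Bpit.boolIndicator (evalFnS n₀ z)]) =
    [true, false] ↔ _
  have hc : chartFnS n₀ c z ∈ Bpit ↔ Set.boolIndicator Bpit (chartFnS n₀ c z) = true :=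
    Set.mem_iff_boolIndicator (Bpit : Set (List Bool)) _
  have he : evalFnS n₀ z ∈ Bpit ↔ Set.boolIndicator Bpit (evalFnS n₀ z) = true :=
    Set.mem_iff_boolIndicator (Bpit : Set (List Bool)) _
  rw [sndF_boolPair, hc, he]
  cases Set.boolIndicator Bpit (chartFnS n₀ c z) <;> cases Set.boolIndicator Bpit (evalFnS n₀ z) <;> simp

/-- **The verifier language**: easy accept, or main case and the two queries succeed.
[cite: BlaserIkenmeyerJindalLysikov2018, Thm. 4 (proof)] -/
def verifierS : Language Bool :=
  ({z | easyFnS B₀ z = [true]} : Language Bool) ⊔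
    (({z | mainFnS B₀ z = [true]} : Language Bool) ⊓ twoQueryS n₀ c Bpit)

/-- **The verifier language is in `BPP`** for `Bpit ∈ BPP`. [cite: BlaserIkenmeyerJindalLysikov2018, Thm. 4 (proof: "It is obviously an ∃BPP algorithm")] -/
theorem verifierS_mem_BPP (hB : Bpit ∈ BPP) : verifierS B₀ n₀ c Bpit ∈ BPP :=
  union_mem_BPP_of_mem_P_left (setOf_apply_eq_apply_mem_P (easyFnS_mem_FP B₀) (const_mem_FP [true]))
    (inter_mem_BPP_of_mem_P_left (setOf_apply_eq_apply_mem_P (mainFnS_mem_FP B₀) (const_mem_FP [true]))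
      (twoQueryS_mem_BPP n₀ c Bpit hB))

end Verifier

/-! ### §2. Correctness of the verifier with an identity test modulo `p` -/

section CorrectnessModP

variable (p : ℕ) {Bpit : Language Bool} (n₀ : ℕ)

/-- The machine's 2-CNF `gjs (padE3 n₀ φ)` is the pipeline's `psi n₀ φ` (syntactic bridge for rewriting).
[cite: GareyJohnsonStockmeyer1976, Thm. 1.1] -/
theorem psi_eq (n₀ : ℕ) (φ : CNF ℕ) : gjs (padE3 n₀ φ) = psi n₀ φ := rfl

/-- The chart-test word is long enough to host its variables (the ballast of the chart circuit).
[cite: BlaserIkenmeyerJindalLysikov2018, Thm. 4 (proof)] -/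
theorem nVarC_le_length_circuitWord (n m c r : ℕ) (Bk : KBlock) :
    nVarC n m c r ≤ (circuitWord (nVarC n m c r) (chartCircuitC n m c r Bk)).length :=
  le_trans (by rw [size_chartCircuitC]; omega) (size_le_length_circuitWord _)

/-- **The two tests read modulo `p`**: acceptance of the two queries by a `Bpit` agreeing, on circuit words, with
"the integer circuit computes `0` modulo `p`" means: the chart-test circuit (slice-rank profile `cOf B₀`) of the
instance of `φ` computes a polynomial `≡ 0 (mod p)`, and its evaluation value is `≢ 0 (mod p)`.
[cite: BlaserIkenmeyerJindalLysikov2018, Thm. 4 (proof, steps (2)–(3))] -/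
theorem testsS_iff_zmod
    (hagree : ∀ (m : ℕ) (C : ArithCircuit ℤ (Fin m)), m ≤ (circuitWord m C).length →
      (circuitWord m C ∈ Bpit ↔ map (Int.castRingHom (ZMod p)) C.eval = 0))
    (c : ℕ) (φ : CNF ℕ) (y : List Bool) :
    (wordE (chartInstS n₀ c (φ, y)) ∈ Bpit ∧ wordE (evalInstS n₀ (φ, y)) ∉ Bpit) ↔
      (map (Int.castRingHom (ZMod p))
          (chartCircuitC (nOf (psi n₀ φ)) (nOf (psi n₀ φ) + 1) c (13 * (φ.length + n₀)) (readBlock y)).eval = 0 ∧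
        ((eval (fun i : Fin (nPos (nOf (psi n₀ φ)) (nOf (psi n₀ φ) + 1)) => entryFn (entries (psi n₀ φ)) i.1)
          (blockPoly (nPos (nOf (psi n₀ φ)) (nOf (psi n₀ φ) + 1)) (readBlock y)) : ℤ) : ZMod p) ≠ 0) := by
  have hc := wordE_chartInstS n₀ c (φ, y)
  have he := wordE_evalInstS n₀ (φ, y)
  dsimp only [length_padE3] at hc he
  rw [hc, he, psi_eq n₀ φ, hagree _ _ (nVarC_le_length_circuitWord _ _ _ _ _), hagree _ _ (Nat.zero_le _),
    eval_evalCircuit, map_C, C_eq_zero, eq_intCast]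

/-- **SOUNDNESS of the verifier (characteristic `p`)**: an accepted pair has its instance outside `E3SATOcc B₀`
(easy cases by inspection; main case by the E3-level soundness of the two tests over an infinite field `K` of
characteristic `p`). [cite: BlaserIkenmeyerJindalLysikov2018, Thm. 4 (proof: "The correctness follows from the construction") and §3 remark after Obs. 17] -/
theorem not_mem_of_mem_verifierS_zmod (K : Type u) [Field K] [CharP K p] [Infinite K] {B₀ : ℕ} (h1 : 1 ≤ B₀)
    (hagree : ∀ (m : ℕ) (C : ArithCircuit ℤ (Fin m)), m ≤ (circuitWord m C).length →
      (circuitWord m C ∈ Bpit ↔ map (Int.castRingHom (ZMod p)) C.eval = 0))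
    {w y : List Bool} (h : boolPair w y ∈ verifierS B₀ n₀ (cOf B₀) Bpit) : w ∉ E3SATOcc B₀ := by
  rcases h with he | ⟨hm, hq⟩
  · have he' : easyFnS B₀ (boolPair w y) = [true] := he
    rw [easyFnS_apply] at he'
    simp only [List.cons.injEq, and_true, Bool.or_eq_true, Bool.not_eq_true', decide_eq_false_iff_not] at he'
    rcases he' with he' | he'
    · exact not_mem_E3SATOcc_of_not_canon he'
    · exact not_mem_E3SATOcc_of_easyS he'
  · have hm' : mainFnS B₀ (boolPair w y) = [true] := hm
    rw [mainFnS_apply] at hm'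
    simp only [List.cons.injEq, and_true, Bool.and_eq_true, decide_eq_true_eq] at hm'
    obtain ⟨hcanon, hmain⟩ := hm'
    obtain ⟨hE, hocc⟩ := (mainS_eq_true_iff _ _).1 hmain
    have hq' := (mem_twoQueryS_iff n₀ (cOf B₀) Bpit (boolPair w y)).1 hq
    rw [chartFnS_apply, evalFnS_apply] at hq'
    obtain ⟨hchart, heval⟩ := (testsS_iff_zmod p n₀ hagree (cOf B₀) (decCNF w) y).1 hq'
    have hno := not_satisfiable_of_testsC_zmod K p hE hocc h1 n₀ (readBlock y) hchart heval
    intro hw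
    rw [← hcanon, encode_mem_E3SATOcc_iff] at hw
    exact hno hw.2.2

/-- **The witness polynomial**: a bound on the code length of the guessed block in the length `L` of the input
(`n = 20 (|φ| + n₀) ≤ 20 (L + n₀)`, positions `(n+2) n²`, `|Bk| ≤ n^k + k + 1`).
[cite: BlaserIkenmeyerJindalLysikov2018, Thm. 4 (proof: "Guess a circuit C of polynomial size")] -/
def witnessPolyS (k n₀ : ℕ) : Polynomial ℕ :=
  ((20 * (Polynomial.X + Polynomial.C n₀)) ^ k + Polynomial.C k + 1) *
    (6 * ((20 * (Polynomial.X + Polynomial.C n₀) + 2) * (20 * (Polynomial.X + Polynomial.C n₀)) ^ 2 +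
      ((20 * (Polynomial.X + Polynomial.C n₀)) ^ k + Polynomial.C k + 1)) + 58)

/-- Evaluation of the witness polynomial. [folklore] -/
private theorem eval_witnessPolyS (k n₀ L : ℕ) : (witnessPolyS k n₀).eval L =
    ((20 * (L + n₀)) ^ k + k + 1) *
      (6 * ((20 * (L + n₀) + 2) * (20 * (L + n₀)) ^ 2 + ((20 * (L + n₀)) ^ k + k + 1)) + 58) := by
  simp [witnessPolyS]

/-- **COMPLETENESS of the verifier (characteristic `p`)** under the easy-equations hypothesis over `K` (the negation of
the strengthened conclusion for exponent `k` from size `n₀` on, for a family `S` cutting out the varieties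
`C^{n,n+1,cOf B₀}_{rSeq n}`): an instance outside `E3SATOcc B₀` has a short accepted witness.
[cite: BlaserIkenmeyerJindalLysikov2018, §3 remark after Obs. 17 and Thm. 4 (proof: "Such a polynomial is guaranteed to exist by assumption")] -/
theorem exists_mem_verifierS_zmod (K : Type u) [Field K] [CharP K p] [Infinite K] {B₀ : ℕ}
    (hagree : ∀ (m : ℕ) (C : ArithCircuit ℤ (Fin m)), m ≤ (circuitWord m C).length →
      (circuitWord m C ∈ Bpit ↔ map (Int.castRingHom (ZMod p)) C.eval = 0))
    {S : ∀ n : ℕ, Set (MvPolynomial (Option (Fin (n + 1)) × Fin n × Fin n) K)}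
    (hS : ∀ n, {A | ∀ q ∈ S n, eval (tensorPoint K A.1 A.2) q = 0} = bijlVariety K n (n + 1) (cOf B₀) (rSeq n))
    {k : ℕ} (hEasy : ∀ n, n₀ ≤ n → ∀ q ∈ S n, ∃ P : ArithCircuit K (Option (Fin (n + 1)) × Fin n × Fin n),
      P.IsFanInTwo ∧ P.HasSignConstants ∧ P.Computes q ∧ P.size ≤ n ^ k + k)
    {w : List Bool} (hw : w ∉ E3SATOcc B₀) :
    ∃ y : List Bool, y.length ≤ (witnessPolyS k n₀).eval w.length ∧ boolPair w y ∈ verifierS B₀ n₀ (cOf B₀) Bpit := by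
  have heasy : easyFnS B₀ (boolPair w []) = [true] → ∃ y : List Bool,
      y.length ≤ (witnessPolyS k n₀).eval w.length ∧ boolPair w y ∈ verifierS B₀ n₀ (cOf B₀) Bpit :=
    fun h => ⟨[], by simp, Or.inl h⟩
  by_cases hcanon : encodingCNF.encode (decCNF w) = w
  swap
  · exact heasy (by rw [easyFnS_apply]; simp [hcanon])
  cases hez : easyS B₀ (decCNF w)
  swap
  · exact heasy (by rw [easyFnS_apply, hez]; simp)
  -- main case: a canonical E3 code with occurrence bound `B₀`, hence unsatisfiable
  have hmz : mainS B₀ (decCNF w) = true := by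
    rw [easyS_eq_not_mainS] at hez; simpa using hez
  obtain ⟨hE, hocc⟩ := (mainS_eq_true_iff _ _).1 hmz
  set φ := decCNF w with hφ
  have hunsat : ¬ φ.Satisfiable := fun hs => hw (by rw [← hcanon, encode_mem_E3SATOcc_iff]; exact ⟨hE, hocc, hs⟩)
  -- the hypothesis at the instance size `n = nOf ψ ≥ n₀`
  have hSn := hS (nOf (psi n₀ φ))
  rw [rSeq_nOf_psi] at hSn
  obtain ⟨Bk, hBlen, hBidx, hchart, heval⟩ :=
    exists_block_of_not_satisfiable_zmod K p hE hunsat B₀ n₀ hSn (hEasy _ (le_nOf_psi n₀ φ))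
  refine ⟨encBlock Bk, ?_, Or.inr ⟨?_, ?_⟩⟩
  · -- the witness is short
    refine (length_encBlock_le hBidx).trans ?_
    rw [eval_witnessPolyS]
    have hL : φ.length ≤ w.length := by
      have h := ThreeDM.length_le_length_encode φ
      rwa [hcanon] at h
    have hn : nOf (psi n₀ φ) ≤ 20 * (w.length + n₀) := by rw [nOf_psi]; omega
    have hB1 : Bk.length ≤ (20 * (w.length + n₀)) ^ k + k + 1 :=
      hBlen.trans (by have := Nat.pow_le_pow_left hn k; omega)
    have hP : nPos (nOf (psi n₀ φ)) (nOf (psi n₀ φ) + 1) ≤ (20 * (w.length + n₀) + 2) * (20 * (w.length + n₀)) ^ 2 := by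
      unfold nPos
      exact Nat.mul_le_mul (by omega) (Nat.pow_le_pow_left hn 2)
    exact Nat.mul_le_mul hB1 (by omega)
  · show mainFnS B₀ (boolPair w (encBlock Bk)) = [true]
    rw [mainFnS_apply, hcanon, ← hφ, hmz]
    simp
  · refine (mem_twoQueryS_iff n₀ (cOf B₀) Bpit _).2 ?_
    rw [chartFnS_apply, evalFnS_apply, ← hφ]
    refine (testsS_iff_zmod p n₀ hagree (cOf B₀) φ (encBlock Bk)).2 ?_
    simp only [readBlock_encBlock]
    exact ⟨hchart, heval⟩

/-- **The complement of `E3SATOcc B₀` is in `∃·BPP`** under the easy-equations hypothesis over `K` (characteristic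
`p`) and a `BPP` identity test modulo `p` for circuit words.
[cite: BlaserIkenmeyerJindalLysikov2018, Thm. 4 (proof: "It is obviously an ∃BPP algorithm") and §3 remark after Obs. 17] -/
theorem compl_E3SATOcc_mem_polyExists_BPP_zmod (K : Type u) [Field K] [CharP K p] [Infinite K] {B₀ : ℕ} (h1 : 1 ≤ B₀)
    (hB : Bpit ∈ BPP)
    (hagree : ∀ (m : ℕ) (C : ArithCircuit ℤ (Fin m)), m ≤ (circuitWord m C).length →
      (circuitWord m C ∈ Bpit ↔ map (Int.castRingHom (ZMod p)) C.eval = 0))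
    {S : ∀ n : ℕ, Set (MvPolynomial (Option (Fin (n + 1)) × Fin n × Fin n) K)}
    (hS : ∀ n, {A | ∀ q ∈ S n, eval (tensorPoint K A.1 A.2) q = 0} = bijlVariety K n (n + 1) (cOf B₀) (rSeq n))
    {k : ℕ} (hEasy : ∀ n, n₀ ≤ n → ∀ q ∈ S n, ∃ P : ArithCircuit K (Option (Fin (n + 1)) × Fin n × Fin n),
      P.IsFanInTwo ∧ P.HasSignConstants ∧ P.Computes q ∧ P.size ≤ n ^ k + k) :
    (E3SATOcc B₀)ᶜ ∈ polyExists BPP := by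
  refine ⟨verifierS B₀ n₀ (cOf B₀) Bpit, verifierS_mem_BPP B₀ n₀ (cOf B₀) Bpit hB, witnessPolyS k n₀,
    fun w => ⟨fun hw => ?_, fun ⟨y, _, hy⟩ => ?_⟩⟩
  · exact exists_mem_verifierS_zmod p n₀ K hagree hS hEasy hw
  · exact not_mem_of_mem_verifierS_zmod p n₀ K h1 hagree hy

end CorrectnessModP

/-! ### §3. The edge and the discharge -/

section Edge

variable (p : ℕ) (K : Type u) [Field K] [CharP K p] [Infinite K]

/-- **BIJL Thm 4 STRENGTHENED (characteristic `p`, `p = 0` included) from a `BPP` identity test modulo `p` for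
integer circuit words**: with `t n = n + 1`, `r n = 13 ⌊n/20⌋`, `c = 20 (B + 1)` (`B` the occurrence constant of
the NP-hard language `E3SATOcc B`), growth constants `a = 4`, `b = 2`, `n₁ = 40`.
[cite: BlaserIkenmeyerJindalLysikov2018, §3 remark after Obs. 17 (ECCC p. 12) and Thm. 4 (proof)] -/
theorem BIJL2018_thm4_strengthened_of_randomizedPITMod {Bpit : Language Bool} (hB : Bpit ∈ BPP)
    (hagree : ∀ (m : ℕ) (C : ArithCircuit ℤ (Fin m)), m ≤ (circuitWord m C).length →
      (circuitWord m C ∈ Bpit ↔ map (Int.castRingHom (ZMod p)) C.eval = 0)) :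
    BIJL2018_thm4_strengthened K := by
  intro hco
  obtain ⟨B₀, h1, hhard⟩ := exists_E3SATOcc_isNPHard
  refine ⟨tSeq, rSeq, cOf B₀, 4, 2, 40, fun n hn => growth_tSeq_rSeq n hn, fun S hS k n₀ => ?_⟩
  by_contra h
  push Not at h
  exact hco (coNP_subset_polyExists_BPP_of_isNPHard_of_compl_mem hhard
    (compl_E3SATOcc_mem_polyExists_BPP_zmod p n₀ K h1 hB hagree (S := S) hS (k := k)
      fun n hn q hq => h n hn q hq))

end Edge

end BIJL2018Thm4S

open Literature.Computability.AlgebraicComplexity in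
/-- **Discharge of `BIJL2018_thm4_strengthened`** (BIJL 2018, the strengthened form of Thm 4 stated after
Obs. 17, every infinite field `K`): the modular reduction `BIJL2018_thm4_strengthened_of_randomizedPITMod` at
`p = ringChar K` (uniform in the characteristic, `0` included: `ZMod 0 = ℤ`) applied to the tree's
`PITLanguageMod (ringChar K) ∈ BPP`. The statement is the closed universal closure over the fact's OWN parameters
(`K` with its `Field`/`Infinite` instances — exactly the binders of `def BIJL2018_thm4_strengthened`) and carries no
hypothesis. [cite: BlaserIkenmeyerJindalLysikov2018, §3 remark after Obs. 17 (ECCC p. 12)] -/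
theorem BIJL2018_thm4_strengthened_holds : ∀ (K : Type u) [Field K] [Infinite K], BIJL2018_thm4_strengthened K :=
  fun K _ _ => BIJL2018Thm4S.BIJL2018_thm4_strengthened_of_randomizedPITMod (ringChar K) K
    (PITLanguageMod_ringChar_mem_BPP K) fun m C _ => circuitWord_mem_PITLanguageMod_iff (ringChar K) m C

end Literature.Barriers.ValiantsHypothesis

end
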